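import Mathlib
import Summits.Ventures.PercRepro2.CoinChainXASixCell
import Summits.Ventures.PercRepro2.CoinChainXASetAD

/-!
# (XA′) on the six-cell sub-case with the TOP GATE — the first mixed-regime kernel theorem beyond four atoms
(blind cell PercRepro2, night-2 g27; proofs/NIGHT2-DARC.md §68.11)

Chain with `ent = {m}`, `ent' = {j, j'}`, entry markers `x = 1[m ∈ ·]`, `y = 1[j ∈ ·]`, and the gate
`d' = d·1[{m, j} ⊆ W]` (the gate is open exactly on the clusters containing both `m` and `j`,
the top cell `D*₁`).  The sign pattern is the MIXED one (`Q_x < 0 < P⁰_x`, `P′_x < 0`, `P⁰_y < 0`, and `Q_y` of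
either sign), so no earlier sign / moment theorem covers it.  The cleared (XA′) `Cross ≤ a0·U001` is, in the
eighteen cell masses of §68.10, the degree-4 polynomial `a0·G` with
  `a0·G = 2(a₀ + a₁)B·[(o + a₀)r₁u − a₁B] + (o + a₀ + a₁)B·[(o + a₀)a₁u − a₁a₀u] + (o + a₀)r₁u·[(o + a₀)r₀u − a₀uB]
          + (53 monomials with positive coefficients)`,   `B = b_u + r₀u`,
the three brackets being SET-LEVEL Ahlswede–Daykin slacks (`ad_sets`): (νc on D′₁) × (νd on D″ ∪ D*₀) ≤ (νc on
I₀ ∪ D′₀) × (νd on D*₁); (νc on D′₁) × (νd on D′₀) ≤ (νc on I₀ ∪ D′₀) × (νd on D′₁); (νd on D′₀) × (νc on D″ ∪ D*₀)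
≤ (νc on I₀ ∪ D′₀) × (νd on D*₀), the last one combined with `d ≤ c`.  `xa_six_topgate_cert` is the certificate
(`linear_combination`), `chain_XA'_six_topgate` the statement on the chain data (the hypothesis `hXA'` of
`chain_functional_nonneg_of_XA'`), `chain_functional_nonneg_six_topgate` the chain at every `ρ`.
-/

namespace Summit.Ventures.PercRepro2.Coin

open Classical

section TopGateCert

variable {R : Type*} [Field R] [LinearOrder R] [IsStrictOrderedRing R]

/-- **THE CERTIFICATE.** Cell masses `o = νc(I₀)`, `a₀ = νc(D′₀)`, `a₁ = νc(D′₁)`, `a₀u = νd(D′₀)`,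
`a₁u = νd(D′₁)`, `bu = νd(D″)`, `r₀u = νd(D*₀)`, `r₁u = νd(D*₁)`; with the top gate the moments are
`a0 = o + a₀ + a₁ + bu + r₀u + r₁u`, `a1 = bu + r₀u + r₁u`, `a2 = a₁ + r₁u`, `b0 = o + a₀u + a₁u + a1`,
`b1 = a1`, `b2 = a₁u + r₁u`, `e0 = o + a₀ + a₁ + r₁u`, `e1 = r₁u`, `e2 = a₁ + r₁u`, `g0 = o + r₁u`,
`g1 = g2 = g12 = r₁u`.  From the three set-level Ahlswede–Daykin inequalities `h1 h2 h3`: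
`Cross ≤ a0·U001`. -/
theorem xa_six_topgate_cert (o a₀ a₁ a₀u a₁u bu r₀u r₁u : R)
    (ho : 0 ≤ o) (ha₀ : 0 ≤ a₀) (ha₁ : 0 ≤ a₁) (ha₀u : 0 ≤ a₀u) (ha₁u : 0 ≤ a₁u)
    (hbu : 0 ≤ bu) (hr₀u : 0 ≤ r₀u) (hr₁u : 0 ≤ r₁u)
    (h1 : a₁ * (bu + r₀u) ≤ (o + a₀) * r₁u) (h3 : a₁ * a₀u ≤ (o + a₀) * a₁u)
    (h2 : a₀u * (bu + r₀u) ≤ (o + a₀) * r₀u) :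
    ((o + a₀ + a₁ + bu + r₀u + r₁u) * (bu + r₀u + r₁u)
        - (bu + r₀u + r₁u) * (o + a₀u + a₁u + bu + r₀u + r₁u)) *
      ((o + a₀ + a₁ + bu + r₀u + r₁u) * (a₁ + r₁u) - (a₁ + r₁u) * (o + a₀ + a₁ + r₁u))
    + ((o + a₀ + a₁ + bu + r₀u + r₁u) * (a₁u + r₁u)
        - (a₁ + r₁u) * (o + a₀u + a₁u + bu + r₀u + r₁u)) *
      ((o + a₀ + a₁ + bu + r₀u + r₁u) * r₁u - (bu + r₀u + r₁u) * (o + a₀ + a₁ + r₁u))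
    ≤ (o + a₀ + a₁ + bu + r₀u + r₁u) *
        ((o + a₀ + a₁ + bu + r₀u + r₁u) * (o + a₀ + a₁ + bu + r₀u + r₁u) * r₁u
          - (o + a₀ + a₁ + bu + r₀u + r₁u) * (a₁ + r₁u) * r₁u
          - (o + a₀ + a₁ + bu + r₀u + r₁u) * (bu + r₀u + r₁u) * r₁u
          + (bu + r₀u + r₁u) * (a₁ + r₁u) * (o + r₁u)) := by
  have hpos : (0 : R) ≤
        a₁u * r₀u * r₁u ^ 2
        + a₁u * r₀u ^ 2 * r₁u
        + a₁u * bu * r₁u ^ 2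
        + 2 * a₁u * bu * r₀u * r₁u
        + a₁u * bu ^ 2 * r₁u
        + a₀u * r₀u * r₁u ^ 2
        + a₀u * r₀u ^ 2 * r₁u
        + a₀u * bu * r₁u ^ 2
        + 2 * a₀u * bu * r₀u * r₁u
        + a₀u * bu ^ 2 * r₁u
        + a₁ * a₁u * r₀u * r₁u
        + 2 * a₁ * a₁u * r₀u ^ 2
        + a₁ * a₁u * bu * r₁u
        + 4 * a₁ * a₁u * bu * r₀u
        + 2 * a₁ * a₁u * bu ^ 2
        + a₁ * a₀u * r₀u ^ 2
        + 2 * a₁ * a₀u * bu * r₀u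
        + a₁ * a₀u * bu ^ 2
        + a₀ * a₁u * r₀u ^ 2
        + 2 * a₀ * a₁u * bu * r₀u
        + a₀ * a₁u * bu ^ 2
        + a₀ * a₁ * r₁u ^ 2
        + a₀ * a₁ * r₀u * r₁u
        + a₀ * a₁ * bu * r₁u
        + a₀ * a₁ ^ 2 * r₁u
        + a₀ ^ 2 * r₁u ^ 2
        + a₀ ^ 2 * bu * r₁u
        + 2 * a₀ ^ 2 * a₁ * r₁u
        + a₀ ^ 3 * r₁u
        + o * r₁u ^ 3
        + 3 * o * r₀u * r₁u ^ 2
        + 2 * o * r₀u ^ 2 * r₁u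
        + 3 * o * bu * r₁u ^ 2
        + 4 * o * bu * r₀u * r₁u
        + 2 * o * bu ^ 2 * r₁u
        + o * a₁u * r₀u ^ 2
        + 2 * o * a₁u * bu * r₀u
        + o * a₁u * bu ^ 2
        + 3 * o * a₁ * r₁u ^ 2
        + 4 * o * a₁ * r₀u * r₁u
        + 4 * o * a₁ * bu * r₁u
        + 2 * o * a₁ ^ 2 * r₁u
        + 3 * o * a₀ * r₁u ^ 2
        + 2 * o * a₀ * r₀u * r₁u
        + 4 * o * a₀ * bu * r₁u
        + 5 * o * a₀ * a₁ * r₁u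
        + 3 * o * a₀ ^ 2 * r₁u
        + 2 * o ^ 2 * r₁u ^ 2
        + 2 * o ^ 2 * r₀u * r₁u
        + 3 * o ^ 2 * bu * r₁u
        + 3 * o ^ 2 * a₁ * r₁u
        + 3 * o ^ 2 * a₀ * r₁u
        + o ^ 3 * r₁u := by positivity
  linear_combination (2 * (a₀ + a₁) * (bu + r₀u)) * h1 + ((o + a₀ + a₁) * (bu + r₀u)) * h3
    + ((o + a₀) * r₁u) * h2 + hpos

end TopGateCert

section TopGateChain

variable {V : Type*} [DecidableEq V] {R : Type*} [Field R] [LinearOrder R] [IsStrictOrderedRing R]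


/-- `ad_sets` with explicit decidability instances on the four predicates (so that the filtered sums
match those of the cell lemmas syntactically). -/
theorem ad_sets_dec (U : Finset V) (L₁ L₂ L₃ L₄ : Finset V → R)
    (h₁ : ∀ W, 0 ≤ L₁ W) (h₂ : ∀ W, 0 ≤ L₂ W) (h₃ : ∀ W, 0 ≤ L₃ W) (h₄ : ∀ W, 0 ≤ L₄ W)
    (PA PB PM PJ : Finset V → Prop) [DecidablePred PA] [DecidablePred PB] [DecidablePred PM]
    [DecidablePred PJ]
    (h : ∀ s ⊆ U, ∀ t ⊆ U, PA s → PB t →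
      PM (s ∩ t) ∧ PJ (s ∪ t) ∧ L₁ s * L₂ t ≤ L₃ (s ∩ t) * L₄ (s ∪ t)) :
    (∑ W ∈ U.powerset.filter PA, L₁ W) * (∑ W ∈ U.powerset.filter PB, L₂ W) ≤
      (∑ W ∈ U.powerset.filter PM, L₃ W) * (∑ W ∈ U.powerset.filter PJ, L₄ W) := by
  simp only [Finset.sum_filter]
  have n₁ : ∀ W, (0 : R) ≤ (if PA W then L₁ W else 0) := fun W => by
    split_ifs <;> first | exact le_rfl | exact h₁ W
  have n₂ : ∀ W, (0 : R) ≤ (if PB W then L₂ W else 0) := fun W => by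
    split_ifs <;> first | exact le_rfl | exact h₂ W
  have n₃ : ∀ W, (0 : R) ≤ (if PM W then L₃ W else 0) := fun W => by
    split_ifs <;> first | exact le_rfl | exact h₃ W
  have n₄ : ∀ W, (0 : R) ≤ (if PJ W then L₄ W else 0) := fun W => by
    split_ifs <;> first | exact le_rfl | exact h₄ W
  refine ad_pointwise U _ _ _ _ n₁ n₂ n₃ n₄ ?_
  intro s hs t ht
  by_cases hA : PA s
  · by_cases hB : PB t
    · obtain ⟨hM, hJ, hle⟩ := h s hs t ht hA hB
      rw [if_pos hA, if_pos hB, if_pos hM, if_pos hJ]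
      exact hle
    · rw [if_neg hB, mul_zero]
      exact mul_nonneg (n₃ _) (n₄ _)
  · rw [if_neg hA, zero_mul]
    exact mul_nonneg (n₃ _) (n₄ _)

omit [IsStrictOrderedRing R] in
/-- The top gate `d' = d·1[{m, j} ⊆ W]` is nonnegative. -/
lemma topGate_nonneg (m j : V) (d d' : Finset V → R) (hd0 : ∀ W, 0 ≤ d W)
    (hd' : ∀ W, d' W = if m ∈ W ∧ j ∈ W then d W else 0) (W : Finset V) : 0 ≤ d' W := by
  rw [hd']; split_ifs <;> first | exact hd0 W | exact le_rfl

omit [IsStrictOrderedRing R] in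
/-- The top gate is below `d`. -/
lemma topGate_le (m j : V) (d d' : Finset V → R) (hd0 : ∀ W, 0 ≤ d W)
    (hd' : ∀ W, d' W = if m ∈ W ∧ j ∈ W then d W else 0) (W : Finset V) : d' W ≤ d W := by
  rw [hd']; split_ifs <;> first | exact le_rfl | exact hd0 W

/-- The top gate is log-supermodular when `d` is. -/
lemma topGate_lsm (m j : V) (d d' : Finset V → R) (hd0 : ∀ W, 0 ≤ d W)
    (hd' : ∀ W, d' W = if m ∈ W ∧ j ∈ W then d W else 0)
    (hdd : ∀ s t, d s * d t ≤ d (s ∩ t) * d (s ∪ t)) (s t : Finset V) :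
    d' s * d' t ≤ d' (s ∩ t) * d' (s ∪ t) := by
  simp only [hd']
  by_cases hs : m ∈ s ∧ j ∈ s
  · by_cases ht : m ∈ t ∧ j ∈ t
    · have hi : m ∈ s ∩ t ∧ j ∈ s ∩ t := ⟨Finset.mem_inter.2 ⟨hs.1, ht.1⟩, Finset.mem_inter.2 ⟨hs.2, ht.2⟩⟩
      have hu : m ∈ s ∪ t ∧ j ∈ s ∪ t := ⟨Finset.mem_union_left _ hs.1, Finset.mem_union_left _ hs.2⟩
      rw [if_pos hs, if_pos ht, if_pos hi, if_pos hu]; exact hdd s t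
    · rw [if_neg ht, mul_zero]
      exact mul_nonneg (by split_ifs <;> first | exact hd0 _ | exact le_rfl)
        (by split_ifs <;> first | exact hd0 _ | exact le_rfl)
  · rw [if_neg hs, zero_mul]
    exact mul_nonneg (by split_ifs <;> first | exact hd0 _ | exact le_rfl)
      (by split_ifs <;> first | exact hd0 _ | exact le_rfl)

/-- Cross log-supermodularity of `f` against the top gate, from that of `f` against `d`. -/
lemma topGate_cross (m j : V) (f d d' : Finset V → R) (hf0 : ∀ W, 0 ≤ f W) (hd0 : ∀ W, 0 ≤ d W)
    (hd' : ∀ W, d' W = if m ∈ W ∧ j ∈ W then d W else 0)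
    (hfd : ∀ s t, f s * d t ≤ f (s ∩ t) * d (s ∪ t)) (s t : Finset V) :
    f s * d' t ≤ f (s ∩ t) * d' (s ∪ t) := by
  simp only [hd']
  by_cases ht : m ∈ t ∧ j ∈ t
  · have hu : m ∈ s ∪ t ∧ j ∈ s ∪ t := ⟨Finset.mem_union_right _ ht.1, Finset.mem_union_right _ ht.2⟩
    rw [if_pos ht, if_pos hu]; exact hfd s t
  · rw [if_neg ht, mul_zero]
    exact mul_nonneg (hf0 _) (by split_ifs <;> first | exact hd0 _ | exact le_rfl)

/-- The ratio `topGate / c` is increasing when `d / c` is. -/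
lemma topGate_ratio (m j : V) (c d d' : Finset V → R) (hc0 : ∀ W, 0 ≤ c W) (hd0 : ∀ W, 0 ≤ d W)
    (hd' : ∀ W, d' W = if m ∈ W ∧ j ∈ W then d W else 0)
    (hratio : ∀ s t, s ⊆ t → d s * c t ≤ c s * d t) (s t : Finset V) (hst : s ⊆ t) :
    d' s * c t ≤ c s * d' t := by
  simp only [hd']
  by_cases hs : m ∈ s ∧ j ∈ s
  · have ht : m ∈ t ∧ j ∈ t := ⟨hst hs.1, hst hs.2⟩
    rw [if_pos hs, if_pos ht]; exact hratio s t hst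
  · rw [if_neg hs, zero_mul]
    exact mul_nonneg (hc0 _) (by split_ifs <;> first | exact hd0 _ | exact le_rfl)

omit [LinearOrder R] [IsStrictOrderedRing R] in
/-- The top gate vanishes on a cell missing `m` or `j`. -/
lemma topGate_cell_zero (U : Finset V) (m j : V) (ν d d' : Finset V → R)
    (hd' : ∀ W, d' W = if m ∈ W ∧ j ∈ W then d W else 0) (P : Finset V → Prop)
    [DecidablePred P] (hP : ∀ W, P W → ¬ (m ∈ W ∧ j ∈ W)) :
    ∑ W ∈ U.powerset.filter P, ν W * d' W = 0 := by
  refine Finset.sum_eq_zero (fun W hW => ?_)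
  rw [hd', if_neg (hP W (Finset.mem_filter.1 hW).2), mul_zero]

omit [LinearOrder R] [IsStrictOrderedRing R] in
/-- The top gate is `d` on the top cell. -/
lemma topGate_cell_full (U : Finset V) (m j : V) (ν d d' : Finset V → R)
    (hd' : ∀ W, d' W = if m ∈ W ∧ j ∈ W then d W else 0) (P : Finset V → Prop)
    [DecidablePred P] (hP : ∀ W, P W → m ∈ W ∧ j ∈ W) :
    ∑ W ∈ U.powerset.filter P, ν W * d' W = ∑ W ∈ U.powerset.filter P, ν W * d W := by
  refine Finset.sum_congr rfl (fun W hW => ?_)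
  rw [hd', if_pos (hP W (Finset.mem_filter.1 hW).2)]

omit [LinearOrder R] [IsStrictOrderedRing R] in
/-- Splitting the cells `{m ∈ W, j ∉ W}` by `j'`. -/
lemma sum_split_x (U : Finset V) (m j j' : V) (f : Finset V → R) :
    ∑ W ∈ U.powerset.filter (fun W => m ∈ W ∧ j ∉ W), f W =
      (∑ W ∈ U.powerset.filter (fun W => m ∈ W ∧ j ∉ W ∧ j' ∉ W), f W)
      + (∑ W ∈ U.powerset.filter (fun W => m ∈ W ∧ j ∉ W ∧ j' ∈ W), f W) := by
  simp only [Finset.sum_filter]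
  rw [← Finset.sum_add_distrib]
  refine Finset.sum_congr rfl (fun W _ => ?_)
  by_cases hm : m ∈ W <;> by_cases hj : j ∈ W <;> by_cases hj' : j' ∈ W <;> simp [hm, hj, hj']

omit [LinearOrder R] [IsStrictOrderedRing R] in
/-- Splitting the cells `{m ∉ W, j ∉ W}` by `j'`. -/
lemma sum_split_low (U : Finset V) (m j j' : V) (f : Finset V → R) :
    ∑ W ∈ U.powerset.filter (fun W => m ∉ W ∧ j ∉ W), f W =
      (∑ W ∈ U.powerset.filter (fun W => m ∉ W ∧ j ∉ W ∧ j' ∉ W), f W)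
      + (∑ W ∈ U.powerset.filter (fun W => m ∉ W ∧ j ∉ W ∧ j' ∈ W), f W) := by
  simp only [Finset.sum_filter]
  rw [← Finset.sum_add_distrib]
  refine Finset.sum_congr rfl (fun W _ => ?_)
  by_cases hm : m ∈ W <;> by_cases hj : j ∈ W <;> by_cases hj' : j' ∈ W <;> simp [hm, hj, hj']

omit [DecidableEq V] in
/-- A cell sum of a nonnegative law is nonnegative. -/
lemma cell_nonneg (U : Finset V) (ν L : Finset V → R) (hν0 : ∀ W, 0 ≤ ν W) (hL0 : ∀ W, 0 ≤ L W)
    (P : Finset V → Prop) [DecidablePred P] : 0 ≤ ∑ W ∈ U.powerset.filter P, ν W * L W :=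
  Finset.sum_nonneg (fun W _ => mul_nonneg (hν0 W) (hL0 W))

/-- **(XA′) FOR THE SIX-CELL SUB-CASE WITH THE TOP GATE** (`ent = {m}`, `ent' = {j, j'}`,
`x = 1[m ∈ ·]`, `y = 1[j ∈ ·]`, `d' = d·1[{m, j} ⊆ W]`): the hypothesis `hXA'` of
`chain_functional_nonneg_of_XA'`, from `ν` log-supermodular, `d ≤ c` and the cross inequality
`c s * d t ≤ c (s ∩ t) * d (s ∪ t)` — by the certificate `xa_six_topgate_cert` and three
set-level Ahlswede–Daykin inequalities (`ad_sets`). -/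
theorem chain_XA'_six_topgate (U : Finset V) (m j j' : V) (ν c d d' : Finset V → R)
    (hν0 : ∀ W, 0 ≤ ν W) (hν : ∀ s ⊆ U, ∀ t ⊆ U, ν s * ν t ≤ ν (s ∩ t) * ν (s ∪ t))
    (hc0 : ∀ W, 0 ≤ c W) (hd0 : ∀ W, 0 ≤ d W) (hdc : ∀ W, d W ≤ c W)
    (hcd : ∀ s t, c s * d t ≤ c (s ∩ t) * d (s ∪ t))
    (hd' : ∀ W, d' W = if m ∈ W ∧ j ∈ W then d W else 0)
    (x y : Finset V → R) (hx : ∀ W, x W = if m ∈ W then 1 else 0)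
    (hy : ∀ W, y W = if j ∈ W then 1 else 0) :
    (((∑ W ∈ U.powerset, ν W * chainMix {m} {j, j'} 0 c d W) * (∑ W ∈ U.powerset, ν W * chainMix {m} {j, j'} 1 c d W * x W) - (∑ W ∈ U.powerset, ν W * chainMix {m} {j, j'} 0 c d W * x W) * (∑ W ∈ U.powerset, ν W * chainMix {m} {j, j'} 1 c d W)) *
          ((∑ W ∈ U.powerset, ν W * chainMix {m} {j, j'} 0 c d W) * (∑ W ∈ U.powerset, ν W * chainMix {m} {j, j'} 0 c d' W * y W) - (∑ W ∈ U.powerset, ν W * chainMix {m} {j, j'} 0 c d W * y W) * (∑ W ∈ U.powerset, ν W * chainMix {m} {j, j'} 0 c d' W))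
        + ((∑ W ∈ U.powerset, ν W * chainMix {m} {j, j'} 0 c d W) * (∑ W ∈ U.powerset, ν W * chainMix {m} {j, j'} 1 c d W * y W) - (∑ W ∈ U.powerset, ν W * chainMix {m} {j, j'} 0 c d W * y W) * (∑ W ∈ U.powerset, ν W * chainMix {m} {j, j'} 1 c d W)) *
          ((∑ W ∈ U.powerset, ν W * chainMix {m} {j, j'} 0 c d W) * (∑ W ∈ U.powerset, ν W * chainMix {m} {j, j'} 0 c d' W * x W) - (∑ W ∈ U.powerset, ν W * chainMix {m} {j, j'} 0 c d W * x W) * (∑ W ∈ U.powerset, ν W * chainMix {m} {j, j'} 0 c d' W))) ≤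
        (∑ W ∈ U.powerset, ν W * chainMix {m} {j, j'} 0 c d W) * ((∑ W ∈ U.powerset, ν W * chainMix {m} {j, j'} 0 c d W) * (∑ W ∈ U.powerset, ν W * chainMix {m} {j, j'} 0 c d W) * (∑ W ∈ U.powerset, ν W * chainMix {m} {j, j'} 1 c d' W * (x W * y W))
          - (∑ W ∈ U.powerset, ν W * chainMix {m} {j, j'} 0 c d W) * (∑ W ∈ U.powerset, ν W * chainMix {m} {j, j'} 0 c d W * y W) * (∑ W ∈ U.powerset, ν W * chainMix {m} {j, j'} 1 c d' W * x W)
          - (∑ W ∈ U.powerset, ν W * chainMix {m} {j, j'} 0 c d W) * (∑ W ∈ U.powerset, ν W * chainMix {m} {j, j'} 0 c d W * x W) * (∑ W ∈ U.powerset, ν W * chainMix {m} {j, j'} 1 c d' W * y W)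
          + (∑ W ∈ U.powerset, ν W * chainMix {m} {j, j'} 0 c d W * x W) * (∑ W ∈ U.powerset, ν W * chainMix {m} {j, j'} 0 c d W * y W) * (∑ W ∈ U.powerset, ν W * chainMix {m} {j, j'} 1 c d' W)) := by
  -- the thirteen moments in the cell masses
  rw [six_a0 U m j j' ν c d, six_a1 U m j j' ν c d x hx, six_a2 U m j j' ν c d y hy,
    six_b0 U m j j' ν c d, six_b1 U m j j' ν c d x hx, six_b2 U m j j' ν c d y hy,
    six_e0 U m j j' ν c d', six_e1 U m j j' ν c d' x hx,
    six_e2 U m j j' ν c d' y hy, six_g0 U m j j' ν c d',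
    six_g1 U m j j' ν c d' x hx, six_g2 U m j j' ν c d' y hy,
    six_g12 U m j j' ν c d' x hx y hy]
  -- the gate cells
  rw [topGate_cell_zero U m j ν d d' hd' (fun W => m ∉ W ∧ j ∉ W ∧ j' ∈ W) (fun W h => fun h' => h.1 h'.1),
    topGate_cell_zero U m j ν d d' hd' (fun W => m ∉ W ∧ j ∈ W) (fun W h => fun h' => h.1 h'.1),
    topGate_cell_zero U m j ν d d' hd' (fun W => m ∈ W ∧ j ∉ W ∧ j' ∉ W) (fun W h => fun h' => h.2.1 h'.2),
    topGate_cell_zero U m j ν d d' hd' (fun W => m ∈ W ∧ j ∉ W ∧ j' ∈ W) (fun W h => fun h' => h.2.1 h'.2),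
    topGate_cell_full U m j ν d d' hd' (fun W => m ∈ W ∧ j ∈ W) (fun W h => h)]
  -- nonnegativity of the eight masses
  have ho := cell_nonneg U ν c hν0 hc0 (fun W => m ∉ W ∧ j ∉ W ∧ j' ∉ W)
  have ha₀ := cell_nonneg U ν c hν0 hc0 (fun W => m ∉ W ∧ j ∉ W ∧ j' ∈ W)
  have ha₁ := cell_nonneg U ν c hν0 hc0 (fun W => m ∉ W ∧ j ∈ W)
  have ha₀u := cell_nonneg U ν d hν0 hd0 (fun W => m ∉ W ∧ j ∉ W ∧ j' ∈ W)
  have ha₁u := cell_nonneg U ν d hν0 hd0 (fun W => m ∉ W ∧ j ∈ W)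
  have hbu := cell_nonneg U ν d hν0 hd0 (fun W => m ∈ W ∧ j ∉ W ∧ j' ∉ W)
  have hr₀u := cell_nonneg U ν d hν0 hd0 (fun W => m ∈ W ∧ j ∉ W ∧ j' ∈ W)
  have hr₁u := cell_nonneg U ν d hν0 hd0 (fun W => m ∈ W ∧ j ∈ W)
  -- the pointwise inequalities of the three set-level Ahlswede–Daykin facts
  have hcd' : ∀ s ⊆ U, ∀ t ⊆ U, ν s * c s * (ν t * d t) ≤ ν (s ∩ t) * c (s ∩ t) * (ν (s ∪ t) * d (s ∪ t)) := by
    intro s hs t ht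
    calc ν s * c s * (ν t * d t) = (ν s * ν t) * (c s * d t) := by ring
      _ ≤ (ν (s ∩ t) * ν (s ∪ t)) * (c (s ∩ t) * d (s ∪ t)) :=
          mul_le_mul (hν s hs t ht) (hcd s t) (mul_nonneg (hc0 _) (hd0 _)) (mul_nonneg (hν0 _) (hν0 _))
      _ = _ := by ring
  have hdc' : ∀ s ⊆ U, ∀ t ⊆ U, ν s * d s * (ν t * c t) ≤ ν (s ∩ t) * c (s ∩ t) * (ν (s ∪ t) * d (s ∪ t)) := by
    intro s hs t ht
    have h := hcd t s
    rw [Finset.inter_comm, Finset.union_comm] at h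
    calc ν s * d s * (ν t * c t) = (ν s * ν t) * (c t * d s) := by ring
      _ ≤ (ν (s ∩ t) * ν (s ∪ t)) * (c (s ∩ t) * d (s ∪ t)) :=
          mul_le_mul (hν s hs t ht) h (mul_nonneg (hc0 _) (hd0 _)) (mul_nonneg (hν0 _) (hν0 _))
      _ = _ := by ring
  -- Fact 1: (νc on D′₁) × (νd on {m ∈ W, j ∉ W}) ≤ (νc on {m, j ∉ W}) × (νd on D*₁)
  have f1 := ad_sets_dec U (fun W => ν W * c W) (fun W => ν W * d W) (fun W => ν W * c W) (fun W => ν W * d W)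
    (fun W => mul_nonneg (hν0 W) (hc0 W)) (fun W => mul_nonneg (hν0 W) (hd0 W))
    (fun W => mul_nonneg (hν0 W) (hc0 W)) (fun W => mul_nonneg (hν0 W) (hd0 W))
    (fun W => m ∉ W ∧ j ∈ W) (fun W => m ∈ W ∧ j ∉ W) (fun W => m ∉ W ∧ j ∉ W) (fun W => m ∈ W ∧ j ∈ W)
    (fun s hs t ht hA hB => ⟨⟨fun h => hA.1 (Finset.mem_inter.1 h).1, fun h => hB.2 (Finset.mem_inter.1 h).2⟩,
      ⟨Finset.mem_union_right _ hB.1, Finset.mem_union_left _ hA.2⟩, hcd' s hs t ht⟩)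
  -- Fact 3: (νc on D′₁) × (νd on D′₀) ≤ (νc on {m, j ∉ W}) × (νd on D′₁)
  have f3 := ad_sets_dec U (fun W => ν W * c W) (fun W => ν W * d W) (fun W => ν W * c W) (fun W => ν W * d W)
    (fun W => mul_nonneg (hν0 W) (hc0 W)) (fun W => mul_nonneg (hν0 W) (hd0 W))
    (fun W => mul_nonneg (hν0 W) (hc0 W)) (fun W => mul_nonneg (hν0 W) (hd0 W))
    (fun W => m ∉ W ∧ j ∈ W) (fun W => m ∉ W ∧ j ∉ W ∧ j' ∈ W) (fun W => m ∉ W ∧ j ∉ W) (fun W => m ∉ W ∧ j ∈ W)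
    (fun s hs t ht hA hB => ⟨⟨fun h => hA.1 (Finset.mem_inter.1 h).1, fun h => hB.2.1 (Finset.mem_inter.1 h).2⟩,
      ⟨fun h => (Finset.mem_union.1 h).elim hA.1 hB.1, Finset.mem_union_left _ hA.2⟩, hcd' s hs t ht⟩)
  -- Fact 2: (νd on D′₀) × (νc on {m ∈ W, j ∉ W}) ≤ (νc on {m, j ∉ W}) × (νd on D*₀)
  have f2 := ad_sets_dec U (fun W => ν W * d W) (fun W => ν W * c W) (fun W => ν W * c W) (fun W => ν W * d W)
    (fun W => mul_nonneg (hν0 W) (hd0 W)) (fun W => mul_nonneg (hν0 W) (hc0 W))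
    (fun W => mul_nonneg (hν0 W) (hc0 W)) (fun W => mul_nonneg (hν0 W) (hd0 W))
    (fun W => m ∉ W ∧ j ∉ W ∧ j' ∈ W) (fun W => m ∈ W ∧ j ∉ W) (fun W => m ∉ W ∧ j ∉ W)
    (fun W => m ∈ W ∧ j ∉ W ∧ j' ∈ W)
    (fun s hs t ht hA hB => ⟨⟨fun h => hA.1 (Finset.mem_inter.1 h).1, fun h => hB.2 (Finset.mem_inter.1 h).2⟩,
      ⟨Finset.mem_union_right _ hB.1, fun h => (Finset.mem_union.1 h).elim hA.2.1 hB.2,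
        Finset.mem_union_left _ hA.2.2⟩, hdc' s hs t ht⟩)
  rw [sum_split_x U m j j', sum_split_low U m j j'] at f1
  rw [sum_split_low U m j j'] at f3
  rw [sum_split_x U m j j', sum_split_low U m j j'] at f2
  -- d ≤ c on the cells {m ∈ W, j ∉ W}
  have hdle : (∑ W ∈ U.powerset.filter (fun W => m ∈ W ∧ j ∉ W ∧ j' ∉ W), ν W * d W)
      + (∑ W ∈ U.powerset.filter (fun W => m ∈ W ∧ j ∉ W ∧ j' ∈ W), ν W * d W)
      ≤ (∑ W ∈ U.powerset.filter (fun W => m ∈ W ∧ j ∉ W ∧ j' ∉ W), ν W * c W)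
      + (∑ W ∈ U.powerset.filter (fun W => m ∈ W ∧ j ∉ W ∧ j' ∈ W), ν W * c W) :=
    add_le_add (Finset.sum_le_sum (fun W _ => mul_le_mul_of_nonneg_left (hdc W) (hν0 W)))
      (Finset.sum_le_sum (fun W _ => mul_le_mul_of_nonneg_left (hdc W) (hν0 W)))
  have h2 := le_trans (mul_le_mul_of_nonneg_left hdle ha₀u) f2
  linear_combination xa_six_topgate_cert _ _ _ _ _ _ _ _ ho ha₀ ha₁ ha₀u ha₁u hbu hr₀u hr₁u f1 f3 h2

/-- **THE CHAIN AT EVERY `ρ` FOR THE SIX-CELL SUB-CASE WITH THE TOP GATE**: the general AND-switch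
chain with `ent = {m}`, `ent' = {j, j'}`, entry markers `x = 1[m ∈ ·]`, `y = 1[j ∈ ·]` and the gate
`d' = d·1[{m, j} ⊆ W]` — from `chain_functional_nonneg_of_XA'` and `chain_XA'_six_topgate` (the gate's
hypotheses are inherited from those of `d`). -/
theorem chain_functional_nonneg_six_topgate (U : Finset V) (m j j' : V) (ν c d d' : Finset V → R)
    (ρ : R) (hρ0 : 0 ≤ ρ) (hρ1 : ρ ≤ 1) (hν0 : ∀ W, 0 ≤ ν W)
    (hν : ∀ s ⊆ U, ∀ t ⊆ U, ν s * ν t ≤ ν (s ∩ t) * ν (s ∪ t))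
    (hc0 : ∀ W, 0 ≤ c W) (hd0 : ∀ W, 0 ≤ d W) (hdc : ∀ W, d W ≤ c W)
    (hcc : ∀ s t, c s * c t ≤ c (s ∩ t) * c (s ∪ t))
    (hdd : ∀ s t, d s * d t ≤ d (s ∩ t) * d (s ∪ t))
    (hcd : ∀ s t, c s * d t ≤ c (s ∩ t) * d (s ∪ t))
    (hratio : ∀ s t, s ⊆ t → d s * c t ≤ c s * d t)
    (hd' : ∀ W, d' W = if m ∈ W ∧ j ∈ W then d W else 0)
    (x y : Finset V → R) (hx : ∀ W, x W = if m ∈ W then 1 else 0)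
    (hy : ∀ W, y W = if j ∈ W then 1 else 0)
    (hpos0 : 0 < ∑ W ∈ U.powerset, ν W * chainMix {m} {j, j'} 0 c d W)
    (hpos1 : 0 < ∑ W ∈ U.powerset, ν W * chainMix {m} {j, j'} 1 c d W)
    (hmI : 0 < ∑ W ∈ U.powerset.filter (fun W => ¬ ∃ r ∈ ({m} : Finset V) ∪ {j, j'}, r ∈ W), ν W * c W) :
    0 ≤ (∑ W ∈ U.powerset, ν W * chainMix {m} {j, j'} ρ c d W) ^ 2 *
          (∑ W ∈ U.powerset, ν W * chainMix {m} {j, j'} ρ c d' W * (x W * y W))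
        - (∑ W ∈ U.powerset, ν W * chainMix {m} {j, j'} ρ c d W) *
          (∑ W ∈ U.powerset, ν W * chainMix {m} {j, j'} ρ c d W * x W) *
          (∑ W ∈ U.powerset, ν W * chainMix {m} {j, j'} ρ c d' W * y W)
        - (∑ W ∈ U.powerset, ν W * chainMix {m} {j, j'} ρ c d W) *
          (∑ W ∈ U.powerset, ν W * chainMix {m} {j, j'} ρ c d W * y W) *
          (∑ W ∈ U.powerset, ν W * chainMix {m} {j, j'} ρ c d' W * x W)
        + (∑ W ∈ U.powerset, ν W * chainMix {m} {j, j'} ρ c d W * x W) *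
          (∑ W ∈ U.powerset, ν W * chainMix {m} {j, j'} ρ c d W * y W) *
          (∑ W ∈ U.powerset, ν W * chainMix {m} {j, j'} ρ c d' W) := by
  have hx0 : ∀ W, 0 ≤ x W := fun W => by rw [hx]; split_ifs <;> norm_num
  have hy0 : ∀ W, 0 ≤ y W := fun W => by rw [hy]; split_ifs <;> norm_num
  have hxm : ∀ s t, x s ≤ x (s ∪ t) := fun s t => by
    rw [hx, hx]
    by_cases hs : m ∈ s
    · rw [if_pos hs, if_pos (Finset.mem_union_left _ hs)]
    · rw [if_neg hs]; split_ifs <;> norm_num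
  have hym : ∀ s t, y s ≤ y (s ∪ t) := fun s t => by
    rw [hy, hy]
    by_cases hs : j ∈ s
    · rw [if_pos hs, if_pos (Finset.mem_union_left _ hs)]
    · rw [if_neg hs]; split_ifs <;> norm_num
  exact chain_functional_nonneg_of_XA' U {m} {j, j'} ν c d d' ρ hρ0 hρ1 hν0 hν hc0 hd0
    (topGate_nonneg m j d d' hd0 hd') hdc (fun W => le_trans (topGate_le m j d d' hd0 hd' W) (hdc W))
    (topGate_le m j d d' hd0 hd') hcc hdd (topGate_lsm m j d d' hd0 hd' hdd) hcd
    (topGate_cross m j c d d' hc0 hd0 hd' hcd) (topGate_cross m j d d d' hd0 hd0 hd' hdd) hratio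
    (topGate_ratio m j c d d' hc0 hd0 hd' hratio) x y hx0 hy0 hxm hym hpos0 hpos1 hmI
    (chain_XA'_six_topgate U m j j' ν c d d' hν0 hν hc0 hd0 hdc hcd hd' x y hx hy)

end TopGateChain

end Summit.Ventures.PercRepro2.Coin
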